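import Summits.QuantumFields.BalabanUV.T4Continuum.Support.AveragingDeficitLatticeH2Prep

/-!
# AveragingDeficitLatticeH2 (T⁴ programme, node NE3, row NE3-R2, gen 4) — THE DISCRETE CACCIOPPOLI INEQUALITY FOR
# SECOND DIFFERENCES on `ℤ^d` (interior `H²` from the flat Laplacian), values in a real inner-product space:
# `Σ_{x ∈ box R y} Σ_{i,j} ‖D_iD_jf(x)‖² ≤ 2(d+1)·Σ_{x ∈ box (R+M+2) y} ‖Δf(x)‖² + 2(6d+1)/M²·Σ_{x ∈ box (R+M+2) y} Σ_i ‖D_if(x)‖²`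

HONEST FRAMING (cell `pub-balaban`, T4-DAG PAGE 1; unit `b2b-balaban-t4-ne3r2-p1` = owner of BINDER-OWNERS row NE3-R2,
gen 4).  The cell's T4 target is the finite-torus continuum limit of the unit-scale averaged loop expectations — NOT
infinite volume, NO mass gap, NOT Clay, NOT summit progress.  PURE LATTICE ANALYSIS (see the header of
`AveragingDeficitLatticeH2Prep` for why the NE3 energy route and row NE3's action sandwich want it: B11 Thm 1 prints sup
bounds on `A`, `∇A`, `ΔA` per cube in a local gauge, the consumers want `‖∇_U F‖_{ℓ²(cube)}`, whose leading term is made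
of all mixed second differences of `A`; these are controlled by `ΔA` in `ℓ²` cube by cube — this file — and NOT in
sup norm, cell numerics N-B8-4 / GAPS G-B11-F3a).  The abstract operator core is `T4ConvexResponse.sum_inner_comp_cutoff_eq`
(§4d there: «the local form … discrete Caccioppoli for second differences … is folklore and is stated, not kernelised»);
here the lattice inequality is PROVED directly: identity
`Σ_{ij}Σ χ²‖D_iD_jf‖² = Σ χ²‖Δf‖² + Σ_jΣ(χ²(x)−χ²(x−e_j))⟪Δf(x), D_jf(x−e_j)⟫ − Σ_{ij}Σ(χ²(x)−χ²(x−e_i))⟪D_jf(x), D_iD_jf(x−e_i)⟫`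
from the two summations by parts of the Prep file, then `|χ²(x) − χ²(x−e_i)| ≤ (χ(x)+χ(x−e_i))/M`, Young's inequality,
the shift invariance of box sums of supported majorants, and absorption of one quarter of the left side.

CONTENT (all [folklore], 0 sorry): §5 `abs_chiSq_sub_le`, `termA_pointwise`, `termB_pointwise` (the two pointwise
Young bounds), `sum_termA_le` (`Σ|A-term| ≤ Σ‖Δf‖² + M⁻²Σ‖D_jf‖²`), `sum_termB_le`
(`Σ|B-term| ≤ ¼Σχ²‖D_iu‖² + 6M⁻²Σ‖u‖²`); §6 **`latticeH2`** (the displayed inequality; constants `2(d+1)`, `2(6d+1)`,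
independent of `R`, `y`, `f`, `E`).  What is NOT here: anything about gauge fields (that is `AveragingDeficitKDatum`),
sharp constants, the torus-global identity (already `T4ConvexResponse.sum_normSq_comp_eq_normSq_laplacian`).
Context: T. Bałaban, Commun. Math. Phys. **102** (1985) 277–309 [Balaban1985Variational], Thm 1 (8)–(10) p. 279 (the
per-cube regularity this inequality converts); continuum model: M. Giaquinta, *Multiple integrals in the calculus of
variations and nonlinear elliptic systems* (1983) Ch. III (Caccioppoli inequality); no printed sentence is a hypothesis.
PLACEMENT: `Summits/QuantumFields/BalabanUV/` (human rule 2026-08-19).  Record: HOME `t4/T4-EST-NE3-R2.md` v0.5.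
-/

set_option autoImplicit false

open scoped BigOperators

namespace Summit.QuantumFields.BalabanUV.T4Continuum.AveragingDeficitLatticeH2

open Literature.MathematicalPhysics.QuantumFieldTheory.Balaban1983to89
open B7Prop1Explicit (Site e e_apply)
open T4AveragingDeficitWall (box)
open AveragingDeficitCounting (box_mono self_mem_box)
open AveragingDeficitLatticeH2Prep

noncomputable section

variable {d : ℕ} {E : Type*} [NormedAddCommGroup E] [InnerProductSpace ℝ E]

/-! ## §5 The boundary terms: pointwise Young bounds and their box sums -/

/-- `|χ²(x) − χ²(x − e_i)| ≤ (1/M)(χ(x) + χ(x − e_i))`. [folklore] -/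
theorem abs_chiSq_sub_le {R M : ℕ} (hM : 1 ≤ M) (y x : Site d) (i : Fin d) :
    |chi R M y x ^ 2 - chi R M y (x - e i) ^ 2| ≤ 1 / M * (chi R M y x + chi R M y (x - e i)) := by
  rw [sq_sub_sq, abs_mul, abs_of_nonneg (add_nonneg (chi_nonneg R M y x) (chi_nonneg R M y _)), mul_comm]
  exact mul_le_mul_of_nonneg_right (abs_chi_sub_le hM y x i) (add_nonneg (chi_nonneg R M y x) (chi_nonneg R M y _))

/-- Young: `2c·p·q ≤ p² + c²q²`-type step for the Laplacian boundary term. [folklore] -/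
theorem termA_pointwise {R M : ℕ} (hM : 1 ≤ M) (y x : Site d) (j : Fin d) (a b : E) :
    |(chi R M y x ^ 2 - chi R M y (x - e j) ^ 2) * inner ℝ a b|
      ≤ ‖a‖ ^ 2 + 1 / (M : ℝ) ^ 2 * (((chi R M y x + chi R M y (x - e j)) / 2) ^ 2 * ‖b‖ ^ 2) := by
  have h1 := abs_chiSq_sub_le (R := R) hM y x j
  have h2 : |inner ℝ a b| ≤ ‖a‖ * ‖b‖ := abs_real_inner_le_norm a b
  have hM' : (0 : ℝ) < M := by exact_mod_cast hM
  set m := chi R M y x + chi R M y (x - e j) with hm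
  have hm0 : 0 ≤ m := add_nonneg (chi_nonneg R M y x) (chi_nonneg R M y _)
  rw [abs_mul]
  calc |chi R M y x ^ 2 - chi R M y (x - e j) ^ 2| * |inner ℝ a b| ≤ (1 / M * m) * (‖a‖ * ‖b‖) :=
        mul_le_mul h1 h2 (abs_nonneg _) (by positivity)
    _ = 2 * ‖a‖ * (m / (2 * M) * ‖b‖) := by field_simp
    _ ≤ ‖a‖ ^ 2 + (m / (2 * M) * ‖b‖) ^ 2 := two_mul_le_add_sq _ _
    _ = ‖a‖ ^ 2 + 1 / (M : ℝ) ^ 2 * ((m / 2) ^ 2 * ‖b‖ ^ 2) := by field_simp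

/-- Young steps for the mixed boundary term: with `δ = χ(x) − χ(x−e_i)`, `c = χ(x−e_i)`, `v = u(x) − u(x−e_i)`:
`|δ(2c+δ)⟪u(x), v⟫| ≤ ¼c²‖v‖² + (11/(2M²))‖u(x)‖² + (1/(2M))|δ|‖u(x−e_i)‖²`. [folklore] -/
theorem termB_pointwise {R M : ℕ} (hM : 1 ≤ M) (y x : Site d) (i : Fin d) (u : Site d → E) :
    |(chi R M y x ^ 2 - chi R M y (x - e i) ^ 2) * inner ℝ (u x) (fd i u (x - e i))|
      ≤ 1 / 4 * (chi R M y (x - e i) ^ 2 * ‖fd i u (x - e i)‖ ^ 2) + 11 / (2 * (M : ℝ) ^ 2) * ‖u x‖ ^ 2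
        + 1 / (2 * M) * (|chi R M y x - chi R M y (x - e i)| * ‖u (x - e i)‖ ^ 2) := by
  have hM' : (0 : ℝ) < M := by exact_mod_cast hM
  have hM1 : (1 : ℝ) ≤ M := by exact_mod_cast hM
  set c := chi R M y (x - e i) with hc
  set δ := chi R M y x - chi R M y (x - e i) with hδ
  set A := ‖u x‖ with hA
  set B := ‖fd i u (x - e i)‖ with hB
  set C := ‖u (x - e i)‖ with hC
  have hc0 : 0 ≤ c := chi_nonneg R M y _
  have hA0 : 0 ≤ A := norm_nonneg _
  have hB0 : 0 ≤ B := norm_nonneg _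
  have hC0 : 0 ≤ C := norm_nonneg _
  have ht0 : 0 ≤ |δ| := abs_nonneg _
  have ht1 : |δ| ≤ 1 / M := abs_chi_sub_le hM y x i
  have htM : |δ| * M ≤ 1 := by rwa [le_div_iff₀ hM'] at ht1
  have hBAC : B ≤ A + C := by
    rw [hB, fd_sub_e]; exact norm_sub_le _ _
  have hΔ : |chi R M y x ^ 2 - chi R M y (x - e i) ^ 2| ≤ |δ| * (2 * c + |δ|) := by
    have : chi R M y x ^ 2 - chi R M y (x - e i) ^ 2 = δ * (2 * c + δ) := by rw [hδ, hc]; ring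
    rw [this, abs_mul]
    exact mul_le_mul_of_nonneg_left ((abs_add_le _ _).trans (by rw [abs_of_nonneg (by positivity)]))
      (abs_nonneg _)
  have hin : |inner ℝ (u x) (fd i u (x - e i))| ≤ A * B := abs_real_inner_le_norm _ _
  rw [abs_mul]
  have step : |chi R M y x ^ 2 - chi R M y (x - e i) ^ 2| * |inner ℝ (u x) (fd i u (x - e i))|
      ≤ |δ| * (2 * c + |δ|) * (A * B) := mul_le_mul hΔ hin (abs_nonneg _) (by positivity)
  refine step.trans ?_
  -- piece 1: 2 c |δ| A B ≤ ¼ c² B² + 4 |δ|² A² ≤ ¼ c² B² + (4/M²) A²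
  have p1 : 2 * c * |δ| * (A * B) ≤ 1 / 4 * (c ^ 2 * B ^ 2) + 4 / (M : ℝ) ^ 2 * A ^ 2 := by
    have h1 : 2 * c * |δ| * (A * B) ≤ 1 / 4 * (c ^ 2 * B ^ 2) + 4 * (|δ| * A) ^ 2 := by
      nlinarith [sq_nonneg (c * B / 2 - 2 * (|δ| * A))]
    have h2 : (|δ| * A) ^ 2 ≤ A ^ 2 / (M : ℝ) ^ 2 := by
      have hδ2 : |δ| ^ 2 ≤ (1 / (M : ℝ)) ^ 2 := pow_le_pow_left₀ ht0 ht1 2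
      rw [mul_pow, show A ^ 2 / (M : ℝ) ^ 2 = (1 / (M : ℝ)) ^ 2 * A ^ 2 by field_simp]
      exact mul_le_mul_of_nonneg_right hδ2 (sq_nonneg A)
    calc _ ≤ 1 / 4 * (c ^ 2 * B ^ 2) + 4 * (|δ| * A) ^ 2 := h1
      _ ≤ 1 / 4 * (c ^ 2 * B ^ 2) + 4 * (A ^ 2 / (M : ℝ) ^ 2) := by gcongr
      _ = _ := by ring
  -- piece 2: |δ|² A B ≤ |δ|² A (A + C) ≤ (1/M²) A² + (|δ|/M) (A² + C²)/2
  have p2 : |δ| * |δ| * (A * B) ≤ 3 / (2 * (M : ℝ) ^ 2) * A ^ 2 + 1 / (2 * M) * (|δ| * C ^ 2) := by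
    have h1 : |δ| * |δ| * (A * B) ≤ |δ| * |δ| * (A * A) + |δ| * (|δ| * (A * C)) := by
      have := mul_le_mul_of_nonneg_left hBAC hA0
      nlinarith [mul_nonneg ht0 ht0]
    have h2 : |δ| * |δ| * (A * A) ≤ 1 / (M : ℝ) ^ 2 * A ^ 2 := by
      rw [div_mul_eq_mul_div, le_div_iff₀ (by positivity), one_mul]
      have : (|δ| * M) * (|δ| * M) ≤ 1 := mul_le_one₀ htM (by positivity) htM
      nlinarith [sq_nonneg A, mul_nonneg hA0 hA0]
    have h3 : |δ| * (A * C) ≤ 1 / M * ((A ^ 2 + C ^ 2) / 2) := by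
      have hAC : A * C ≤ (A ^ 2 + C ^ 2) / 2 := by nlinarith [sq_nonneg (A - C)]
      calc |δ| * (A * C) ≤ |δ| * ((A ^ 2 + C ^ 2) / 2) := mul_le_mul_of_nonneg_left hAC ht0
        _ ≤ 1 / M * ((A ^ 2 + C ^ 2) / 2) := mul_le_mul_of_nonneg_right ht1 (by positivity)
    have h4 : |δ| * (|δ| * (A * C)) ≤ |δ| * (1 / M * ((A ^ 2 + C ^ 2) / 2)) := mul_le_mul_of_nonneg_left h3 ht0
    have h5 : |δ| * (1 / M * (A ^ 2 / 2)) ≤ 1 / M * (1 / M * (A ^ 2 / 2)) :=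
      mul_le_mul_of_nonneg_right ht1 (by positivity)
    calc |δ| * |δ| * (A * B) ≤ |δ| * |δ| * (A * A) + |δ| * (|δ| * (A * C)) := h1
      _ ≤ 1 / (M : ℝ) ^ 2 * A ^ 2 + |δ| * (1 / M * ((A ^ 2 + C ^ 2) / 2)) := add_le_add h2 h4
      _ = 1 / (M : ℝ) ^ 2 * A ^ 2 + |δ| * (1 / M * (A ^ 2 / 2)) + 1 / (2 * M) * (|δ| * C ^ 2) := by ring
      _ ≤ 1 / (M : ℝ) ^ 2 * A ^ 2 + 1 / M * (1 / M * (A ^ 2 / 2)) + 1 / (2 * M) * (|δ| * C ^ 2) := by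
          gcongr
      _ = _ := by field_simp; ring
  have e1 : |δ| * (2 * c + |δ|) * (A * B) = 2 * c * |δ| * (A * B) + |δ| * |δ| * (A * B) := by ring
  rw [e1]
  calc 2 * c * |δ| * (A * B) + |δ| * |δ| * (A * B)
      ≤ (1 / 4 * (c ^ 2 * B ^ 2) + 4 / (M : ℝ) ^ 2 * A ^ 2)
        + (3 / (2 * (M : ℝ) ^ 2) * A ^ 2 + 1 / (2 * M) * (|δ| * C ^ 2)) := add_le_add p1 p2
    _ = _ := by ring


/-- The Laplacian boundary term summed over the box (shift invariance of the supported majorant). [folklore] -/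
theorem sum_termA_le {R M : ℕ} (hM : 1 ≤ M) (y : Site d) (j : Fin d) (f : Site d → E) :
    ∑ x ∈ box (R + M + 2) y, |(chi R M y x ^ 2 - chi R M y (x - e j) ^ 2) * inner ℝ (lap f x) (fd j f (x - e j))|
      ≤ ∑ x ∈ box (R + M + 2) y, ‖lap f x‖ ^ 2
        + 1 / (M : ℝ) ^ 2 * ∑ x ∈ box (R + M + 2) y, ‖fd j f x‖ ^ 2 := by
  set σ : Site d → ℝ := fun z => ((chi R M y (z + e j) + chi R M y z) / 2) ^ 2 * ‖fd j f z‖ ^ 2 with hσ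
  have hσK : ∀ z, z ∉ box (R + M + 1) y → σ z = 0 := by
    intro z hz
    have h1 : chi R M y z = 0 := chi_eq_zero_of_not_mem hM fun h => hz (box_mono (by omega) y h)
    have h2 : chi R M y (z + e j) = 0 := chi_eq_zero_of_not_mem hM (add_e_not_mem hz j)
    simp [hσ, h1, h2]
  have hshift := sum_box_shift (R := R + M + 2) (K := R + M + 1) (by omega) y j σ hσK
  have hσle : ∀ z, σ z ≤ ‖fd j f z‖ ^ 2 := by
    intro z
    have hm0 : 0 ≤ (chi R M y (z + e j) + chi R M y z) / 2 := by
      have := chi_nonneg R M y (z + e j); have := chi_nonneg R M y z; positivity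
    have hm1 : (chi R M y (z + e j) + chi R M y z) / 2 ≤ 1 := by
      have := chi_le_one R M y (z + e j); have := chi_le_one R M y z; linarith
    exact mul_le_of_le_one_left (sq_nonneg _) (pow_le_one₀ hm0 hm1)
  calc ∑ x ∈ box (R + M + 2) y,
        |(chi R M y x ^ 2 - chi R M y (x - e j) ^ 2) * inner ℝ (lap f x) (fd j f (x - e j))|
      ≤ ∑ x ∈ box (R + M + 2) y, (‖lap f x‖ ^ 2 + 1 / (M : ℝ) ^ 2 * σ (x - e j)) :=
        Finset.sum_le_sum fun x _ => by
          have h := termA_pointwise (R := R) hM y x j (lap f x) (fd j f (x - e j))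
          simp only [hσ, sub_add_cancel]
          exact h
    _ = ∑ x ∈ box (R + M + 2) y, ‖lap f x‖ ^ 2 + 1 / (M : ℝ) ^ 2 * ∑ x ∈ box (R + M + 2) y, σ x := by
        rw [Finset.sum_add_distrib, ← Finset.mul_sum, hshift]
    _ ≤ _ := by
        gcongr with x _
        exact hσle x

/-- The mixed boundary term summed over the box: a quarter of the main quantity plus first differences.
[folklore] -/
theorem sum_termB_le {R M : ℕ} (hM : 1 ≤ M) (y : Site d) (i : Fin d) (u : Site d → E) :
    ∑ x ∈ box (R + M + 2) y, |(chi R M y x ^ 2 - chi R M y (x - e i) ^ 2) * inner ℝ (u x) (fd i u (x - e i))|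
      ≤ 1 / 4 * ∑ x ∈ box (R + M + 2) y, chi R M y x ^ 2 * ‖fd i u x‖ ^ 2
        + 6 / (M : ℝ) ^ 2 * ∑ x ∈ box (R + M + 2) y, ‖u x‖ ^ 2 := by
  have hM' : (0 : ℝ) < M := by exact_mod_cast hM
  set g : Site d → ℝ := fun z => chi R M y z ^ 2 * ‖fd i u z‖ ^ 2 with hg
  set τ : Site d → ℝ := fun z => |chi R M y (z + e i) - chi R M y z| * ‖u z‖ ^ 2 with hτ
  have hgK : ∀ z, z ∉ box (R + M + 1) y → g z = 0 := by
    intro z hz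
    have h1 : chi R M y z = 0 := chi_eq_zero_of_not_mem hM fun h => hz (box_mono (by omega) y h)
    simp [hg, h1]
  have hτK : ∀ z, z ∉ box (R + M + 1) y → τ z = 0 := by
    intro z hz
    have h1 : chi R M y z = 0 := chi_eq_zero_of_not_mem hM fun h => hz (box_mono (by omega) y h)
    have h2 : chi R M y (z + e i) = 0 := chi_eq_zero_of_not_mem hM (add_e_not_mem hz i)
    simp [hτ, h1, h2]
  have hgshift := sum_box_shift (R := R + M + 2) (K := R + M + 1) (by omega) y i g hgK
  have hτshift := sum_box_shift (R := R + M + 2) (K := R + M + 1) (by omega) y i τ hτK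
  have hτle : ∀ z, τ z ≤ 1 / M * ‖u z‖ ^ 2 := fun z =>
    mul_le_mul_of_nonneg_right (abs_chi_add_sub_le hM y z i) (sq_nonneg _)
  calc ∑ x ∈ box (R + M + 2) y, |(chi R M y x ^ 2 - chi R M y (x - e i) ^ 2) * inner ℝ (u x) (fd i u (x - e i))|
      ≤ ∑ x ∈ box (R + M + 2) y,
          (1 / 4 * g (x - e i) + 11 / (2 * (M : ℝ) ^ 2) * ‖u x‖ ^ 2 + 1 / (2 * M) * τ (x - e i)) :=
        Finset.sum_le_sum fun x _ => by
          have h := termB_pointwise (R := R) hM y x i u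
          simp only [hg, hτ, sub_add_cancel]
          exact h
    _ = 1 / 4 * ∑ x ∈ box (R + M + 2) y, g x + 11 / (2 * (M : ℝ) ^ 2) * ∑ x ∈ box (R + M + 2) y, ‖u x‖ ^ 2
          + 1 / (2 * M) * ∑ x ∈ box (R + M + 2) y, τ x := by
        rw [Finset.sum_add_distrib, Finset.sum_add_distrib, ← Finset.mul_sum, ← Finset.mul_sum, ← Finset.mul_sum,
          hgshift, hτshift]
    _ ≤ 1 / 4 * ∑ x ∈ box (R + M + 2) y, g x + 11 / (2 * (M : ℝ) ^ 2) * ∑ x ∈ box (R + M + 2) y, ‖u x‖ ^ 2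
          + 1 / (2 * M) * ∑ x ∈ box (R + M + 2) y, 1 / M * ‖u x‖ ^ 2 := by
        gcongr with x _
        exact hτle x
    _ = _ := by
        rw [← Finset.mul_sum]
        field_simp
        ring

/-! ## §6 THE DISCRETE CACCIOPPOLI INEQUALITY FOR SECOND DIFFERENCES -/

/-- **DISCRETE CACCIOPPOLI INEQUALITY FOR SECOND DIFFERENCES (interior `H²` from the Laplacian), on `ℤ^d`, with
values in a real inner-product space.**  For every `f : ℤ^d → E`, centre `y`, radius `R` and collar width `M ≥ 1`:
`Σ_{x ∈ box R y} Σ_{i,j} ‖D_iD_jf(x)‖² ≤ 2(d+1)·Σ_{x ∈ box (R+M+2) y} ‖Δf(x)‖² + 2(6d+1)/M²·Σ_{x ∈ box (R+M+2) y} Σ_i ‖D_if(x)‖²`.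
ALL mixed second differences on the inner box are controlled in `ℓ²` by the flat Laplacian on a fat box plus first
differences divided by the collar width — the lattice, localised form of `Σ_{ij}‖∂_i∂_jf‖² = ‖Δf‖²`
(`T4ConvexResponse.sum_normSq_comp_eq_normSq_laplacian`, whose abstract cutoff core is
`T4ConvexResponse.sum_inner_comp_cutoff_eq`; here proved directly on the lattice by two summations by parts against
`χ²`, `χ` the piecewise-linear cutoff, Young's inequality and absorption of a quarter of the left side).  No constant
depends on `R`, `y`, `f` or `E`. [folklore] -/
theorem latticeH2 (f : Site d → E) (y : Site d) (R M : ℕ) (hM : 1 ≤ M) :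
    ∑ x ∈ box R y, ∑ i, ∑ j, ‖fd i (fd j f) x‖ ^ 2
      ≤ 2 * (d + 1) * ∑ x ∈ box (R + M + 2) y, ‖lap f x‖ ^ 2
        + 2 * (6 * d + 1) / (M : ℝ) ^ 2 * ∑ x ∈ box (R + M + 2) y, ∑ i, ‖fd i f x‖ ^ 2 := by
  have hM' : (0 : ℝ) < M := by exact_mod_cast hM
  have hχK : ∀ x, x ∉ box (R + M + 1) y → chi R M y x = 0 := fun x hx =>
    chi_eq_zero_of_not_mem hM fun h => hx (box_mono (by omega) y h)
  have hKR : R + M + 1 + 1 ≤ R + M + 2 := le_rfl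
  set Ω := box (R + M + 2) y with hΩ
  set A := ∑ x ∈ Ω, ‖lap f x‖ ^ 2 with hA
  set Bj : Fin d → ℝ := fun j => ∑ x ∈ Ω, ‖fd j f x‖ ^ 2 with hBj
  set S : Fin d → ℝ := fun j => ∑ i, ∑ x ∈ Ω, chi R M y x ^ 2 * ‖fd i (fd j f) x‖ ^ 2 with hS
  -- the per-`j` estimate
  have S_le : ∀ j, S j ≤ ∑ x ∈ Ω, chi R M y x ^ 2 * inner ℝ (lap f x) (sd j f x)
      + (A + 1 / (M : ℝ) ^ 2 * Bj j) + (1 / 4 * S j + d * (6 / (M : ℝ) ^ 2 * Bj j)) := by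
    intro j
    have h1 : S j = ∑ i, (-∑ x ∈ Ω, chi R M y x ^ 2 * inner ℝ (fd j f x) (sd i (fd j f) x)
        - ∑ x ∈ Ω, (chi R M y x ^ 2 - chi R M y (x - e i) ^ 2) * inner ℝ (fd j f x) (fd i (fd j f) (x - e i))) :=
      Finset.sum_congr rfl fun i _ => sum_sq_fd_eq hKR y i (chi R M y) hχK (fd j f)
    have h2 : ∑ i, ∑ x ∈ Ω, chi R M y x ^ 2 * inner ℝ (fd j f x) (sd i (fd j f) x)
        = ∑ x ∈ Ω, chi R M y x ^ 2 * inner ℝ (fd j f x) (fd j (lap f) x) := by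
      rw [Finset.sum_comm]
      refine Finset.sum_congr rfl fun x _ => ?_
      rw [← Finset.mul_sum, ← inner_sum, ← lap_fd]
      rfl
    have h3 := neg_sum_fd_lap_eq hKR y j (chi R M y) hχK f
    have hQ : ∑ x ∈ Ω, (chi R M y x ^ 2 - chi R M y (x - e j) ^ 2) * inner ℝ (lap f x) (fd j f (x - e j))
        ≤ A + 1 / (M : ℝ) ^ 2 * Bj j :=
      (le_abs_self _).trans ((Finset.abs_sum_le_sum_abs _ _).trans (sum_termA_le hM y j f))
    have hR : ∑ i, -∑ x ∈ Ω, (chi R M y x ^ 2 - chi R M y (x - e i) ^ 2)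
          * inner ℝ (fd j f x) (fd i (fd j f) (x - e i))
        ≤ ∑ i, (1 / 4 * ∑ x ∈ Ω, chi R M y x ^ 2 * ‖fd i (fd j f) x‖ ^ 2 + 6 / (M : ℝ) ^ 2 * Bj j) :=
      Finset.sum_le_sum fun i _ =>
        (neg_le_abs _).trans ((Finset.abs_sum_le_sum_abs _ _).trans (sum_termB_le hM y i (fd j f)))
    rw [Finset.sum_add_distrib, ← Finset.mul_sum, Finset.sum_const, Finset.card_univ, Fintype.card_fin,
      nsmul_eq_mul] at hR
    rw [← hΩ] at h3
    have hSj : S j = (∑ x ∈ Ω, chi R M y x ^ 2 * inner ℝ (lap f x) (sd j f x)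
        + ∑ x ∈ Ω, (chi R M y x ^ 2 - chi R M y (x - e j) ^ 2) * inner ℝ (lap f x) (fd j f (x - e j)))
        - ∑ i, ∑ x ∈ Ω, (chi R M y x ^ 2 - chi R M y (x - e i) ^ 2)
          * inner ℝ (fd j f x) (fd i (fd j f) (x - e i)) := by
      rw [h1, Finset.sum_sub_distrib, Finset.sum_neg_distrib, h2, h3]
    have hR' : -∑ i, ∑ x ∈ Ω, (chi R M y x ^ 2 - chi R M y (x - e i) ^ 2)
          * inner ℝ (fd j f x) (fd i (fd j f) (x - e i))
        ≤ 1 / 4 * S j + d * (6 / (M : ℝ) ^ 2 * Bj j) := by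
      rw [← Finset.sum_neg_distrib]; exact hR
    linarith
  -- sum over `j`
  have hP : ∑ j, ∑ x ∈ Ω, chi R M y x ^ 2 * inner ℝ (lap f x) (sd j f x) ≤ A := by
    rw [Finset.sum_comm]
    refine Finset.sum_le_sum fun x _ => ?_
    rw [← Finset.mul_sum, ← inner_sum, show ∑ j, sd j f x = lap f x from rfl, real_inner_self_eq_norm_sq]
    have h1 : chi R M y x ^ 2 ≤ 1 := pow_le_one₀ (chi_nonneg R M y x) (chi_le_one R M y x)
    exact mul_le_of_le_one_left (sq_nonneg _) h1
  have hT : ∑ j, S j ≤ A + (d * A + 1 / (M : ℝ) ^ 2 * ∑ j, Bj j)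
      + (1 / 4 * ∑ j, S j + d * (6 / (M : ℝ) ^ 2 * ∑ j, Bj j)) := by
    have h := Finset.sum_le_sum fun j (_ : j ∈ (Finset.univ : Finset (Fin d))) => S_le j
    rw [Finset.sum_add_distrib, Finset.sum_add_distrib, Finset.sum_add_distrib, Finset.sum_add_distrib,
      ← Finset.mul_sum, ← Finset.mul_sum, ← Finset.mul_sum, ← Finset.mul_sum, Finset.sum_const, Finset.card_univ,
      Fintype.card_fin, nsmul_eq_mul] at h
    linarith
  -- the left side is at most `Σ_j S j`
  have hL : ∑ x ∈ box R y, ∑ i, ∑ j, ‖fd i (fd j f) x‖ ^ 2 ≤ ∑ j, S j := by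
    calc ∑ x ∈ box R y, ∑ i, ∑ j, ‖fd i (fd j f) x‖ ^ 2
        = ∑ x ∈ box R y, ∑ i, ∑ j, chi R M y x ^ 2 * ‖fd i (fd j f) x‖ ^ 2 :=
          Finset.sum_congr rfl fun x hx => by rw [chi_eq_one_of_mem hx]; simp
      _ ≤ ∑ x ∈ Ω, ∑ i, ∑ j, chi R M y x ^ 2 * ‖fd i (fd j f) x‖ ^ 2 :=
          Finset.sum_le_sum_of_subset_of_nonneg (box_mono (by omega) y) fun x _ _ => by positivity
      _ = ∑ x ∈ Ω, ∑ j, ∑ i, chi R M y x ^ 2 * ‖fd i (fd j f) x‖ ^ 2 :=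
          Finset.sum_congr rfl fun x _ => Finset.sum_comm
      _ = ∑ j, ∑ x ∈ Ω, ∑ i, chi R M y x ^ 2 * ‖fd i (fd j f) x‖ ^ 2 := Finset.sum_comm
      _ = ∑ j, S j := Finset.sum_congr rfl fun j _ => Finset.sum_comm
  have hB : ∑ j, Bj j = ∑ x ∈ Ω, ∑ i, ‖fd i f x‖ ^ 2 := by rw [Finset.sum_comm]
  have hA0 : 0 ≤ A := by positivity
  have hB0 : 0 ≤ ∑ j, Bj j := Finset.sum_nonneg fun j _ => by positivity
  have hd0 : (0 : ℝ) ≤ d := Nat.cast_nonneg d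
  rw [← hB]
  have hM2 : (0 : ℝ) < (M : ℝ) ^ 2 := by positivity
  have key : (3 : ℝ) / 4 * ∑ j, S j ≤ (d + 1) * A + (6 * d + 1) / (M : ℝ) ^ 2 * ∑ j, Bj j := by
    have e1 : (d + 1) * A + (6 * d + 1) / (M : ℝ) ^ 2 * ∑ j, Bj j
        = A + (d * A + 1 / (M : ℝ) ^ 2 * ∑ j, Bj j) + d * (6 / (M : ℝ) ^ 2 * ∑ j, Bj j) := by
      field_simp; ring
    rw [e1]; linarith
  have hX0 : 0 ≤ (d + 1) * A + (6 * d + 1) / (M : ℝ) ^ 2 * ∑ j, Bj j := by positivity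
  calc ∑ x ∈ box R y, ∑ i, ∑ j, ‖fd i (fd j f) x‖ ^ 2 ≤ ∑ j, S j := hL
    _ ≤ 2 * ((d + 1) * A + (6 * d + 1) / (M : ℝ) ^ 2 * ∑ j, Bj j) := by linarith
    _ = _ := by ring

end

end Summit.QuantumFields.BalabanUV.T4Continuum.AveragingDeficitLatticeH2
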